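import Summits.HodgeConjecture.HodgeConjecture.Theorems.Ring2WeilCoverageCMFieldRationalClassesPrimeSupportCyclic
import Summits.HodgeConjecture.HodgeConjecture.Theorems.Ring2WeilCoverageCMFieldRationalClassesCyclicFibres
import Summits.HodgeConjecture.HodgeConjecture.Theorems.Ring2WeilCoverageCMFieldRationalClassesCyclicCond40
import Summits.HodgeConjecture.HodgeConjecture.Theorems.Ring2WeilCoverageCMFieldCyclicPrimeRuleSqrtFiveB
import HarnessLib

/-!
# Ring 2 — Weil-family coverage, CM-field rows: the union statement for the cyclic table `E = ℚ(ζ₅)`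
  (`F = ℚ(√5)`) (WEIL-FAMILY-COVERAGE «## b03», cell (xxi⁸), part 49)

research route conditional on HC_CM; not a corollary; Q11.4-sentence-2 already refuted in dim ≥ 3.

Carrier `R = S² + 5S + 5` (`θ = η² = -(5+√5)/2`, `θ² = 5(θ+2)²`, `q = 5 = (2θ+5)²`, `p² - 4q = 5`; rows
`δ ∈ F^×/Nm_{E/F}(E^×)` labelled by `T(t) = {𝔭 : (t, θ)_𝔭 = -1}`) [cite: Deligne1982HodgeCycles, §4 p. 30, (1), Cor. 4.2].
`F = ℚ(√5)` has ONE place ramified over `ℚ`, `v₅ = (√5)`, one (inert) dyadic place `(2)`, and the prime rule of part 25 reads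
`[ℓ] = [1] ⟺ ℓ = 5 ∨ ℓ ≡ 1 (mod 5)`.  This file discharges the hypotheses of parts 46–47 for this carrier
and states the complete description of the rational classes:

* §141 `v₅ ∈ T(ℓ) ⟺ ℓ ≡ ±2 (mod 5)` (closed form 63:11a at the odd place `v₅`: `ord θ = 1`, `ℓ` a square mod `v₅` iff mod
  `5`); every other place lying in `T(ℓ)` contains `ℓ` (odd places: 63:12; the dyadic place `(2)`: fibre parity — inert
  `ℓ`: `T(ℓ) ∖ {(2)} = {v₅, (ℓ)}`, split `ℓ`: `∅` or a pair); places over `2`, `5` unique.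
* §142 **THE UNION STATEMENT**: for `c ∈ ℚ_{>0}` and a finite place `v ≠ v₅` over `ℓ`:
  **`v ∈ T(c) ⟺ ord_ℓ(c)` odd `∧ ¬(ℓ = 5 ∨ ℓ ≡ 1 (mod 5))`**; at the ramified place:
  **`v₅ ∈ T(c) ⟺` the number of prime factors `ℓ ≡ ±2 (mod 5)` of `num(c)·den(c)`, with multiplicity, is odd**;
  **`[c] = [c'] ⟺` equal exponent parities at every non-norm prime**; **`[c] = [1] ⟺` all even**.

No new definition, no named fact, no sorry; nothing about the Hodge conjecture is asserted.
-/

noncomputable section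

set_option linter.dupNamespace false

open Polynomial NumberField IsDedekindDomain

namespace Summit.HodgeConjecture.HodgeConjecture.Ring2.WeilCoverageCM

open Literature.AlgebraicGeometry.Deligne1982
open Literature.AlgebraicGeometry.HodgeTheory (splitDiscriminantClassCM)
open Literature.NumberTheory.QuadraticForms

variable {R : Polynomial ℤ} [Fact (Irreducible (cmPolyQ R))] [Fact (Irreducible (realPolyQ R))]

/-! ### §141 `ℚ(ζ₅)`: the ramified place `v₅`, the other places, uniqueness over `2` and `5` -/

section Cond5

omit [Fact (Irreducible (cmPolyQ R))] in
/-- `ℚ(ζ₅)`: **the places of `F` over the primes dividing `2q = 10` (i.e. `2`, `5`) are unique** (`(2)` inert,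
`(√5)` ramified). [folklore] -/
theorem zeta5_places_unique_of_dvd (hR : R = X ^ 2 + C 5 * X + C 5) {ℓ : ℕ} (hℓ : ℓ.Prime)
    (hdvd : (ℓ : ℤ) ∣ 2 * 5) (v v' : HeightOneSpectrum (𝓞 (realField R))) (hv : (ℓ : 𝓞 (realField R)) ∈ v.asIdeal)
    (hv' : (ℓ : 𝓞 (realField R)) ∈ v'.asIdeal) : v = v' := by
  have h235 : ℓ ∣ 2 ^ 1 * 3 ^ 0 * 5 ^ 1 := by norm_num; exact_mod_cast hdvd
  rcases eq_of_prime_dvd_two_pow_mul hℓ h235 with rfl | rfl | rfl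
  · exact zeta5_ratPrimeRule_dyadic_unique hR v v' (by exact_mod_cast hv) (by exact_mod_cast hv')
  · omega
  · obtain ⟨s, -, hs⟩ := zeta5_ratPrimeRule_exists_sq_eq_five hR
    have hs' : s ^ 2 = (5 : ℕ) * 1 := by rw [hs]; norm_num
    exact place_unique_of_sq_eq_mul (finrank_realField_quadratic hR) Nat.prime_five hs'
      (show (0 : 𝓞 (realField R)) * (5 : ℕ) + 1 * 1 = 1 by norm_num) v v' hv hv'

/-- `ℚ(ζ₅)`: `T(5) = ∅` (`5 = (2θ+5)²` is a square in `F`). [cite: Deligne1982HodgeCycles, §4 Cor. 4.2] -/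
theorem zeta5_badPlaces_five (hR : R = X ^ 2 + C 5 * X + C 5) :
    badPlaces ((5 : ℕ) : realField R) (AdjoinRoot.root (realPolyQ R)) = ∅ := by
  have h0 : ((5 : ℕ) : realField R) ≠ 0 := by norm_num
  have h := (mk_eq_splitDiscriminantClassCM_iff_badPlaces_eq_empty (R := R) (Units.mk0 ((5 : ℕ) : realField R) h0) even_two).1
    (zeta5_ratPrimeRule_mk_five_eq_splitDiscriminantClassCM hR _ (by rw [Units.val_mk0, Nat.cast_ofNat]) even_two)
  rwa [Units.val_mk0] at h

/-- **`ℚ(ζ₅)`: the RAMIFIED place `v₅ = (√5)` lies in `T(ℓ)` iff `ℓ ≡ ±2 (mod 5)`** (for `ℓ ≠ 5`: `ℓ` is a `v₅`-unit,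
`ord_{v₅} θ = 1` — `θ² = 5(θ+2)²` — and 63:11a gives `(ℓ, θ)_{v₅} = -1 ⟺ ℓ` non-square in `𝓞/v₅ = 𝔽₅`; `T(5) = ∅`).
[cite: Omeara1963, §63B Cor. 63:11a] [cite: Deligne1982HodgeCycles, §4 (1)] -/
theorem zeta5_inl_mem_badPlaces_natCast_iff_of_mem_five (hR : R = X ^ 2 + C 5 * X + C 5)
    (v : HeightOneSpectrum (𝓞 (realField R))) (h5 : (5 : 𝓞 (realField R)) ∈ v.asIdeal) {ℓ : ℕ} (hℓ : ℓ.Prime) :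
    Sum.inl v ∈ badPlaces (ℓ : realField R) (AdjoinRoot.root (realPolyQ R)) ↔ ℓ % 5 = 2 ∨ ℓ % 5 = 3 := by
  by_cases hℓ5 : ℓ = 5
  · subst hℓ5
    rw [zeta5_badPlaces_five hR]
    exact iff_of_false (Set.notMem_empty _) (by norm_num)
  have hK := finrank_realField_quadratic hR
  obtain ⟨hRm, -⟩ := monic_and_natDegree_of_quadratic R hR
  obtain ⟨θₒ, hθ⟩ := exists_ringOfIntegers_coe_eq_root hRm
  have hrel := ringOfIntegers_root_rel_quadratic hR hθ
  push_cast at hrel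
  obtain ⟨s, -, hs⟩ := zeta5_ratPrimeRule_exists_sq_eq_five hR
  have hs' : s ^ 2 = (5 : ℕ) * 1 := by rw [hs]; norm_num
  have hab : (0 : 𝓞 (realField R)) * (5 : ℕ) + 1 * 1 = 1 := by norm_num
  have h5' : ((5 : ℕ) : 𝓞 (realField R)) ∈ v.asIdeal := by exact_mod_cast h5
  have hN := absNorm_eq_of_sq_eq_mul hK Nat.prime_five hs' hab v h5'
  have h5Z : ((5 : ℤ) : 𝓞 (realField R)) ∈ v.asIdeal := by exact_mod_cast h5
  have h2v : (2 : 𝓞 (realField R)) ∉ v.asIdeal := by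
    have := intCast_notMem_of_isCoprime v (show IsCoprime (5 : ℤ) 2 by norm_num) h5Z
    exact_mod_cast this
  have hℓv : (ℓ : 𝓞 (realField R)) ∉ v.asIdeal := fun h ↦ hℓ5 (prime_natCast_mem_unique hℓ Nat.prime_five v h h5')
  have hm : θₒ + 2 ∉ v.asIdeal := fun h ↦ v.isPrime.ne_top ((Ideal.eq_top_iff_one _).2 (by
    have e : (1 : 𝓞 (realField R)) = -((θₒ + 2) * (-θₒ - 3)) + -(θₒ ^ 2 + 5 * θₒ + 5) := by ring
    rw [e, hrel, neg_zero, add_zero]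
    exact v.asIdeal.neg_mem (v.asIdeal.mul_mem_right _ h)))
  have hθm : θₒ ^ 2 = (5 : ℕ) * (θₒ + 2) ^ 2 := by push_cast; linear_combination (-4 : 𝓞 (realField R)) * hrel
  have hodd := odd_log_valuation_of_sq_eq_prime_mul_sq hK Nat.prime_five hs' hab v h5' hθm hm
  have hfac : AdjoinRoot.root (realPolyQ R) = (1 : realField R) ^ 2 * (θₒ : realField R) := by rw [one_pow, one_mul, hθ]
  have key := inl_mem_badPlaces_coe_iff_of_notMem hfac v h2v (u := (ℓ : 𝓞 (realField R))) hℓv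
  rw [show (((ℓ : 𝓞 (realField R))) : realField R) = (ℓ : realField R) from map_natCast (algebraMap _ _) ℓ] at key
  rw [key, and_iff_left hodd]
  have e := isSquare_intCast_residue_iff_of_absNorm_eq v Nat.prime_five hN ℓ
  rw [Int.cast_natCast, Int.cast_natCast] at e
  rw [e, isSquare_natCast_zmod_five_iff]
  have h0 : ℓ % 5 ≠ 0 := fun h ↦ hℓ5 ((Nat.prime_dvd_prime_iff_eq Nat.prime_five hℓ).1 (Nat.dvd_of_mod_eq_zero h)).symm
  omega

/-- `ℚ(ζ₅)`: **an odd place `u ≠ v₅` lying in `T(ℓ)` contains `ℓ`** (`θ ∉ u`, as `θ ∈ u` forces `5 ∈ u`; 63:12).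
[cite: Omeara1963, §63B Example 63:12] -/
theorem zeta5_natCast_mem_of_inl_mem_badPlaces_of_odd (hR : R = X ^ 2 + C 5 * X + C 5)
    (u : HeightOneSpectrum (𝓞 (realField R))) (h2 : (2 : 𝓞 (realField R)) ∉ u.asIdeal)
    (h5 : (5 : 𝓞 (realField R)) ∉ u.asIdeal) {ℓ : ℕ} (hℓ : ℓ.Prime)
    (hu : Sum.inl u ∈ badPlaces (ℓ : realField R) (AdjoinRoot.root (realPolyQ R))) : (ℓ : 𝓞 (realField R)) ∈ u.asIdeal := by
  obtain ⟨hRm, -⟩ := monic_and_natDegree_of_quadratic R hR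
  obtain ⟨θₒ, hθ⟩ := exists_ringOfIntegers_coe_eq_root hRm
  have hθu : θₒ ∉ u.asIdeal := fun h ↦ by
    have hq : ((5 : ℤ) : 𝓞 (realField R)) ∈ u.asIdeal := intCast_mem_of_root_mem hR hθ u h
    exact h5 (by exact_mod_cast hq)
  have hfac : AdjoinRoot.root (realPolyQ R) = (1 : realField R) ^ 2 * (θₒ : realField R) := by rw [one_pow, one_mul, hθ]
  exact natCast_mem_of_inl_mem_badPlaces hfac u h2 hθu hℓ hu

/-- `ℚ(ζ₅)`: **the dyadic place `(2)` lies in no `T(ℓ)`, `ℓ ≠ 2`** — by fibre parity (part 47 (a)): for `ℓ` inert in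
`F` (`ℓ ≡ ±2 (5)`), `T(ℓ) ∖ {(2)} = {v₅, (ℓ)}`; for `ℓ` split, `v₅ ∉ T(ℓ)` and the bad places over `ℓ` come in pairs; `T(5) = ∅`.
[cite: Omeara1963, §71D Thm. 71:18 and §63B Example 63:12] [cite: Deligne1982HodgeCycles, §4 (1)] -/
theorem zeta5_inl_notMem_badPlaces_natCast_of_mem_two (hR : R = X ^ 2 + C 5 * X + C 5)
    (v₂ : HeightOneSpectrum (𝓞 (realField R))) (h2 : (2 : 𝓞 (realField R)) ∈ v₂.asIdeal) {ℓ : ℕ} (hℓ : ℓ.Prime)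
    (hℓ2 : ℓ ≠ 2) : Sum.inl v₂ ∉ badPlaces (ℓ : realField R) (AdjoinRoot.root (realPolyQ R)) := by
  by_cases hℓ5 : ℓ = 5
  · subst hℓ5; rw [zeta5_badPlaces_five hR]; exact Set.notMem_empty _
  haveI := Fact.mk hℓ
  have hK := finrank_realField_quadratic hR
  have hroots := roots_real_neg_of_quadratic hR (by norm_num) (by norm_num) (by norm_num)
  obtain ⟨hRm, -⟩ := monic_and_natDegree_of_quadratic R hR
  obtain ⟨θₒ, hθ⟩ := exists_ringOfIntegers_coe_eq_root hRm
  have hrel := ringOfIntegers_root_rel_quadratic hR hθ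
  push_cast at hrel
  have hs₀ : (2 * θₒ + 5) ^ 2 = ((5 : ℤ) : 𝓞 (realField R)) := by push_cast; linear_combination (4 : 𝓞 (realField R)) * hrel
  obtain ⟨v₅, hv₅⟩ := exists_place_natCast_mem hK Nat.prime_five
  have h5Z : ((5 : ℤ) : 𝓞 (realField R)) ∈ v₅.asIdeal := by exact_mod_cast hv₅
  have h2d : (2 : 𝓞 (realField R)) ∉ v₅.asIdeal := by
    have := intCast_notMem_of_isCoprime v₅ (show IsCoprime (5 : ℤ) 2 by norm_num) h5Z
    exact_mod_cast this
  have huniq2 : ∀ u : HeightOneSpectrum (𝓞 (realField R)), (2 : 𝓞 (realField R)) ∈ u.asIdeal → u = v₂ := fun u hu ↦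
    zeta5_ratPrimeRule_dyadic_unique hR u v₂ hu h2
  have hmod0 : ℓ % 5 ≠ 0 := fun h ↦ hℓ5 ((Nat.prime_dvd_prime_iff_eq Nat.prime_five hℓ).1 (Nat.dvd_of_mod_eq_zero h)).symm
  have hℓdvd : ¬ (ℓ : ℤ) ∣ 5 := fun h ↦ hℓ5 ((Nat.prime_dvd_prime_iff_eq hℓ Nat.prime_five).1 (by exact_mod_cast h))
  refine inl_notMem_badPlaces_natCast_of_fibre_parity hroots v₂ v₅ h2 huniq2 h2d hℓ hℓ2 ?_ ?_ ?_
  · -- H1: a non-dyadic bad place is `v₅` or contains `ℓ`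
    intro u h2u hu
    by_cases h5u : (5 : 𝓞 (realField R)) ∈ u.asIdeal
    · exact Or.inl (zeta5_places_unique_of_dvd hR Nat.prime_five (by norm_num) u v₅
        (by exact_mod_cast h5u) hv₅)
    · exact Or.inr (zeta5_natCast_mem_of_inl_mem_badPlaces_of_odd hR u h2u h5u hℓ hu)
  · -- H2: `v₅` bad ⟹ `ℓ` inert: the fibre is one bad place
    intro hd
    have hin := (zeta5_inl_mem_badPlaces_natCast_iff_of_mem_five hR v₅ (by exact_mod_cast hv₅) hℓ).1 hd
    have hn5 : ¬ IsSquare (5 : ZMod ℓ) := not_isSquare_five_of_mod_five hℓ2 hin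
    have hdisc : ¬ IsSquare (((5 : ℤ) ^ 2 - 4 * 5 : ℤ) : ZMod ℓ) := by
      have e : (((5 : ℤ) ^ 2 - 4 * 5 : ℤ) : ZMod ℓ) = 5 := by push_cast; norm_num
      rw [e]; exact hn5
    have hq : ¬ IsSquare (((5 : ℤ) : ℤ) : ZMod ℓ) := by
      have e : (((5 : ℤ) : ℤ) : ZMod ℓ) = 5 := by push_cast; norm_num
      rw [e]; exact hn5
    obtain ⟨u, hℓu⟩ := exists_place_natCast_mem hK hℓ
    refine ⟨fun h ↦ hℓ5 (prime_natCast_mem_unique hℓ Nat.prime_five v₅ h (by exact_mod_cast hv₅)),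
      ⟨u, hℓu, inl_mem_badPlaces_natCast_of_not_isSquare_disc_const hR hθ hℓ hℓ2 hdisc hq u hℓu⟩, fun u₁ u₂ h₁ h₂ ↦ ?_⟩
    have hN := absNorm_eq_sq_of_not_isSquare_disc hR hθ hℓ hdisc u₁ h₁
    exact (eq_of_natCast_mem_of_absNorm_eq_sq hK hℓ u₁ u₂ h₁ h₂ hN).symm
  · -- H3: `v₅` not bad ⟹ `ℓ` split: bad places over `ℓ` come in pairs
    intro hd w hℓw hw
    have hsp : ℓ % 5 = 1 ∨ ℓ % 5 = 4 := by
      have h := (zeta5_inl_mem_badPlaces_natCast_iff_of_mem_five hR v₅ (by exact_mod_cast hv₅) hℓ).not.1 hd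
      omega
    have hdsq : IsSquare (((5 : ℤ) ^ 2 - 4 * 5 : ℤ) : ZMod ℓ) := by
      have e : (((5 : ℤ) ^ 2 - 4 * 5 : ℤ) : ZMod ℓ) = 5 := by push_cast; norm_num
      rw [e, isSquare_five_iff hℓ2 hℓ5]; exact hsp
    exact exists_partner_of_isSquare_disc hR hθ hs₀ hℓ hℓ2 hℓdvd (by norm_num; exact hℓdvd) hdsq w hℓw hw

/-- `ℚ(ζ₅)`: **every place `v ≠ v₅` lying in some `T(ℓ)` contains `ℓ`** (the hypothesis `hfix` of part 46).
[cite: Omeara1963, §63B Example 63:12 and §71D Thm. 71:18] -/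
theorem zeta5_natCast_mem_of_inl_mem_badPlaces (hR : R = X ^ 2 + C 5 * X + C 5)
    (v : HeightOneSpectrum (𝓞 (realField R))) (h5 : (5 : 𝓞 (realField R)) ∉ v.asIdeal) (ℓ : ℕ) (hℓ : ℓ.Prime)
    (hv : Sum.inl v ∈ badPlaces (ℓ : realField R) (AdjoinRoot.root (realPolyQ R))) : (ℓ : 𝓞 (realField R)) ∈ v.asIdeal := by
  by_cases h2 : (2 : 𝓞 (realField R)) ∈ v.asIdeal
  · by_cases hℓ2 : ℓ = 2
    · subst hℓ2; exact_mod_cast h2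
    · exact absurd hv (zeta5_inl_notMem_badPlaces_natCast_of_mem_two hR v h2 hℓ hℓ2)
  · exact zeta5_natCast_mem_of_inl_mem_badPlaces_of_odd hR v h2 h5 hℓ hv

/-! ### §142 `ℚ(ζ₅)`: the union statement and the classes of the positive rationals -/

/-- **`ℚ(ζ₅)` — THE UNION STATEMENT away from `v₅`**: for `c ∈ ℚ_{>0}` and a finite place `v ≠ v₅` of `F = ℚ(√5)` over
the prime `ℓ`: **`v ∈ T(c) ⟺ ord_ℓ(c)` is odd `∧ ¬(ℓ = 5 ∨ ℓ ≡ 1 (mod 5))`**. [cite: Deligne1982HodgeCycles, §4 (1)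
and Cor. 4.2] [cite: Omeara1963, §63B Example 63:12 and §71D Thm. 71:18] -/
theorem zeta5_inl_mem_badPlaces_ratCast_iff_odd_padicValRat (hR : R = X ^ 2 + C 5 * X + C 5)
    {c : ℚ} (hc : 0 < c) (v : HeightOneSpectrum (𝓞 (realField R))) (h5 : (5 : 𝓞 (realField R)) ∉ v.asIdeal)
    {ℓ : ℕ} (hℓ : ℓ.Prime) (hℓv : (ℓ : 𝓞 (realField R)) ∈ v.asIdeal) :
    Sum.inl v ∈ badPlaces (c : realField R) (AdjoinRoot.root (realPolyQ R)) ↔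
      Odd (padicValRat ℓ c) ∧ ¬ (ℓ = 5 ∨ ℓ % 5 = 1) := by
  have hroots := roots_real_neg_of_quadratic hR (by norm_num) (by norm_num) (by norm_num)
  obtain ⟨hRm, -⟩ := monic_and_natDegree_of_quadratic R hR
  obtain ⟨θₒ, hθ⟩ := exists_ringOfIntegers_coe_eq_root hRm
  have hrel := ringOfIntegers_root_rel_quadratic hR hθ
  push_cast at hrel
  have hs₀ : (2 * θₒ + 5) ^ 2 = ((5 : ℤ) : 𝓞 (realField R)) := by push_cast; linear_combination (4 : 𝓞 (realField R)) * hrel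
  have hℓ0 : (ℓ : realField R) ≠ 0 := by exact_mod_cast hℓ.ne_zero
  have hT := badPlaces_nonempty_iff_mk_ne_splitDiscriminantClassCM (R := R) (Units.mk0 (ℓ : realField R) hℓ0) even_two
  rw [Units.val_mk0, Ne, zeta5_ratPrimeRule_mk_prime_eq_splitDiscriminantClassCM_iff_mod hR hℓ _ (Units.val_mk0 _) even_two] at hT
  rw [inl_mem_badPlaces_ratCast_iff_odd_padicValRat_of_ramified hR hroots hθ hs₀ Nat.prime_five (by norm_num)
    (fun ℓ' hℓ' hd ↦ zeta5_places_unique_of_dvd hR hℓ' hd)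
    (fun u hu ↦ zeta5_natCast_mem_of_inl_mem_badPlaces hR u (by exact_mod_cast hu)) hc v
    (by exact_mod_cast h5) hℓ hℓv, hT]

/-- **`ℚ(ζ₅)` — THE RAMIFIED PLACE**: for `c ∈ ℚ_{>0}`, **`v₅ ∈ T(c)` iff the number of prime factors `ℓ ≡ ±2 (mod 5)`
of `num(c)·den(c)`, counted with multiplicity, is odd** (`v₅ ∈ T(ℓ) ⟺ ℓ ≡ ±2 (5)`, parity of the prime support).
[cite: Deligne1982HodgeCycles, §4 (1)] [cite: Omeara1963, §63B Cor. 63:11a] -/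
theorem zeta5_inl_mem_badPlaces_ratCast_iff_of_mem_five (hR : R = X ^ 2 + C 5 * X + C 5)
    {c : ℚ} (hc : 0 < c) (v : HeightOneSpectrum (𝓞 (realField R))) (h5 : (5 : 𝓞 (realField R)) ∈ v.asIdeal) :
    Sum.inl v ∈ badPlaces (c : realField R) (AdjoinRoot.root (realPolyQ R)) ↔
      Odd ((c.num.natAbs * c.den).factorization.sum fun ℓ e ↦ if ℓ % 5 = 2 ∨ ℓ % 5 = 3 then e else 0) :=
  mem_badPlaces_ratCast_iff_odd_sum_factorization _ (fun ℓ ↦ ℓ % 5 = 2 ∨ ℓ % 5 = 3)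
    (fun _ hℓ ↦ zeta5_inl_mem_badPlaces_natCast_iff_of_mem_five hR v h5 hℓ) hc

/-- **`ℚ(ζ₅)` — THE CLASSES OF THE POSITIVE RATIONALS**: for `c, c' ∈ ℚ_{>0}`, **`[c] = [c']` in `F^×/Nm_{E/F}(E^×)`
iff `ord_ℓ(c) ≡ ord_ℓ(c') (mod 2)` for every prime `ℓ ≠ 5` with `ℓ ≢ 1 (mod 5)`**.
[cite: Deligne1982HodgeCycles, §4 (1), Prop. 4.1 and Cor. 4.2] [cite: Omeara1963, §65D Thm. 65:23 and §71D Thm. 71:18] -/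
theorem zeta5_mk_ratCast_eq_mk_ratCast_iff (hR : R = X ^ 2 + C 5 * X + C 5) {c c' : ℚ}
    (hc : 0 < c) (hc' : 0 < c') (γ γ' : (realField R)ˣ) (hγ : (γ : realField R) = (c : realField R))
    (hγ' : (γ' : realField R) = (c' : realField R)) :
    (QuotientGroup.mk γ : cmNormResidueGroup R) = QuotientGroup.mk γ' ↔
      ∀ ℓ : ℕ, ℓ.Prime → ¬ (ℓ = 5 ∨ ℓ % 5 = 1) →
        (Odd (padicValRat ℓ c) ↔ Odd (padicValRat ℓ c')) := by
  have hroots := roots_real_neg_of_quadratic hR (by norm_num) (by norm_num) (by norm_num)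
  obtain ⟨hRm, -⟩ := monic_and_natDegree_of_quadratic R hR
  obtain ⟨θₒ, hθ⟩ := exists_ringOfIntegers_coe_eq_root hRm
  have hrel := ringOfIntegers_root_rel_quadratic hR hθ
  push_cast at hrel
  have hs₀ : (2 * θₒ + 5) ^ 2 = ((5 : ℤ) : 𝓞 (realField R)) := by push_cast; linear_combination (4 : 𝓞 (realField R)) * hrel
  rw [mk_ratCast_eq_mk_ratCast_iff_of_ramified hR hroots hθ hs₀ Nat.prime_five (by norm_num)
    (fun ℓ' hℓ' hd ↦ zeta5_places_unique_of_dvd hR hℓ' hd)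
    (fun u hu ↦ zeta5_natCast_mem_of_inl_mem_badPlaces hR u (by exact_mod_cast hu))
    (zeta5_badPlaces_five hR) hc hc' γ γ' hγ hγ']
  refine forall_congr' fun ℓ ↦ forall_congr' fun hℓ ↦ ?_
  have hℓ0 : (ℓ : realField R) ≠ 0 := by exact_mod_cast hℓ.ne_zero
  have hT := badPlaces_nonempty_iff_mk_ne_splitDiscriminantClassCM (R := R) (Units.mk0 (ℓ : realField R) hℓ0) even_two
  rw [Units.val_mk0, Ne, zeta5_ratPrimeRule_mk_prime_eq_splitDiscriminantClassCM_iff_mod hR hℓ _ (Units.val_mk0 _) even_two] at hT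
  rw [hT]

/-- **`ℚ(ζ₅)` — THE SPLIT ROW**: for `c ∈ ℚ_{>0}`, **`[c] = [(-1)^k]` (`k` even) iff `ord_ℓ(c)` is even for every prime
`ℓ ≠ 5` with `ℓ ≢ 1 (mod 5)`.** [cite: Deligne1982HodgeCycles, §4 Cor. 4.2] [cite: Omeara1963, §65D Thm. 65:23] -/
theorem zeta5_mk_ratCast_eq_splitDiscriminantClassCM_iff (hR : R = X ^ 2 + C 5 * X + C 5) {c : ℚ}
    (hc : 0 < c) (γ : (realField R)ˣ) (hγ : (γ : realField R) = (c : realField R)) {k : ℕ} (hk : Even k) :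
    (QuotientGroup.mk γ : cmNormResidueGroup R) = splitDiscriminantClassCM R k ↔
      ∀ ℓ : ℕ, ℓ.Prime → ¬ (ℓ = 5 ∨ ℓ % 5 = 1) →
        Even (padicValRat ℓ c) := by
  have hroots := roots_real_neg_of_quadratic hR (by norm_num) (by norm_num) (by norm_num)
  obtain ⟨hRm, -⟩ := monic_and_natDegree_of_quadratic R hR
  obtain ⟨θₒ, hθ⟩ := exists_ringOfIntegers_coe_eq_root hRm
  have hrel := ringOfIntegers_root_rel_quadratic hR hθ
  push_cast at hrel
  have hs₀ : (2 * θₒ + 5) ^ 2 = ((5 : ℤ) : 𝓞 (realField R)) := by push_cast; linear_combination (4 : 𝓞 (realField R)) * hrel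
  rw [mk_ratCast_eq_splitDiscriminantClassCM_iff_of_ramified hR hroots hθ hs₀ Nat.prime_five (by norm_num)
    (fun ℓ' hℓ' hd ↦ zeta5_places_unique_of_dvd hR hℓ' hd)
    (fun u hu ↦ zeta5_natCast_mem_of_inl_mem_badPlaces hR u (by exact_mod_cast hu))
    (zeta5_badPlaces_five hR) hc γ hγ hk]
  refine forall_congr' fun ℓ ↦ forall_congr' fun hℓ ↦ ?_
  have hℓ0 : (ℓ : realField R) ≠ 0 := by exact_mod_cast hℓ.ne_zero
  have hT := badPlaces_nonempty_iff_mk_ne_splitDiscriminantClassCM (R := R) (Units.mk0 (ℓ : realField R) hℓ0) even_two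
  rw [Units.val_mk0, Ne, zeta5_ratPrimeRule_mk_prime_eq_splitDiscriminantClassCM_iff_mod hR hℓ _ (Units.val_mk0 _) even_two] at hT
  rw [hT]

end Cond5

end Summit.HodgeConjecture.HodgeConjecture.Ring2.WeilCoverageCM

end
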